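import Mathlib.Analysis.SpecialFunctions.Complex.Analytic
import Mathlib.Analysis.Complex.CauchyIntegral
import Mathlib.Analysis.Analytic.IsolatedZeros
import Mathlib.Algebra.MvPolynomial.Funext
import Mathlib.Algebra.Polynomial.Roots
import Mathlib.Data.Fin.VecNotation
import HarnessLib

/-!
# The curve `z ↦ (z, e^z)` is Zariski dense: zeros of `P(z, e^z)`

For a non-zero polynomial `P ∈ ℂ[X, Y]` the entire function `F_P(z) = P(z, e^z)` does not vanish
identically (`exp` is transcendental over `ℂ(z)`); we give the elementary periodicity proof:
if `F_P ≡ 0` then `w ↦ P(w, e^z)` has the infinitely many roots `z + 2πik`, so `P(w, e^z) = 0`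
for all `w, z`, and then `v ↦ P(w, v)` vanishes on `ℂˣ = exp(ℂ)`, so `P = 0`
(`eq_zero_of_forall_eval_exp_eq_zero`). Consequences recorded for use on exponential points of
curves:

* `finite_zeros_eval_exp_of_isCompact` — `F_P` has finitely many zeros in every compact set;
* `eval_exp_const_of_isPreconnected` — a continuous function `f` on a preconnected set with
  `P(f, e^f) = 0` pointwise is constant there (its image is a preconnected subset of the discrete
  zero set of `F_P`): the form in which "`e^f` algebraic over `ℂ(f)` forces `f` constant" is used.

[folklore]

## References

* M. Waldschmidt, *Diophantine Approximation on Linear Algebraic Groups*, Springer 2000, §1.1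
  (algebraic independence of `z` and `e^z` as functions). [folklore]
-/

noncomputable section

open Complex MvPolynomial Filter Topology Set

namespace Literature.NumberTheory.Transcendental

/-! ### Specialising one variable -/

/-- `P(w, c)` as a polynomial in `w`: evaluation. [folklore] -/
theorem eval_aeval_X_C (P : MvPolynomial (Fin 2) ℂ) (c w : ℂ) :
    (aeval ![Polynomial.X, Polynomial.C c] P).eval w = eval ![w, c] P := by
  induction P using MvPolynomial.induction_on with
  | C a => simp
  | add p q hp hq => simp [hp, hq]
  | mul_X p i hp =>
    rw [map_mul, map_mul, Polynomial.eval_mul, hp, aeval_X, eval_X]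
    fin_cases i <;> simp

/-- `P(w, v)` as a polynomial in `v`: evaluation. [folklore] -/
theorem eval_aeval_C_X (P : MvPolynomial (Fin 2) ℂ) (w v : ℂ) :
    (aeval ![Polynomial.C w, Polynomial.X] P).eval v = eval ![w, v] P := by
  induction P using MvPolynomial.induction_on with
  | C a => simp
  | add p q hp hq => simp [hp, hq]
  | mul_X p i hp =>
    rw [map_mul, map_mul, Polynomial.eval_mul, hp, aeval_X, eval_X]
    fin_cases i <;> simp

/-! ### `P(z, e^z) ≡ 0` forces `P = 0` -/

/-- **`z` and `e^z` are algebraically independent functions**: if `P(z, e^z) = 0` for all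
`z ∈ ℂ` then `P = 0`. [folklore] -/
theorem eq_zero_of_forall_eval_exp_eq_zero (P : MvPolynomial (Fin 2) ℂ)
    (h : ∀ z : ℂ, eval ![z, exp z] P = 0) : P = 0 := by
  -- Step 1: `P(w, e^z) = 0` for all `w, z` (periodicity in `w`).
  have h1 : ∀ z w : ℂ, eval ![w, exp z] P = 0 := by
    intro z w
    have hzero : aeval ![Polynomial.X, Polynomial.C (exp z)] P = 0 := by
      apply Polynomial.eq_zero_of_infinite_isRoot
      have hsub : Set.range (fun k : ℕ => z + 2 * Real.pi * I * k) ⊆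
          {x | Polynomial.IsRoot (aeval ![Polynomial.X, Polynomial.C (exp z)] P) x} := by
        rintro _ ⟨k, rfl⟩
        rw [Set.mem_setOf_eq, Polynomial.IsRoot.def, eval_aeval_X_C]
        have hper : exp (z + 2 * Real.pi * I * k) = exp z := by
          rw [Complex.exp_add, mul_comm (2 * ↑Real.pi * I) (k : ℂ), Complex.exp_nat_mul_two_pi_mul_I,
            mul_one]
        rw [← hper]
        exact h _
      refine Set.Infinite.mono hsub (Set.infinite_range_of_injective ?_)
      intro a b hab
      have h2 : (2 * Real.pi * I : ℂ) ≠ 0 := by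
        simp [Real.pi_ne_zero, I_ne_zero]
      have : (a : ℂ) = b := by
        have := hab
        simp only [add_right_inj] at this
        exact mul_left_cancel₀ h2 this
      exact_mod_cast this
    have := congrArg (fun q => Polynomial.eval w q) hzero
    simpa [eval_aeval_X_C] using this
  -- Step 2: `P(w, v) = 0` for all `w` and all `v ≠ 0`, hence for all `v`.
  have h2 : ∀ w v : ℂ, eval ![w, v] P = 0 := by
    intro w v
    have hzero : aeval ![Polynomial.C w, Polynomial.X] P = 0 := by
      apply Polynomial.eq_zero_of_infinite_isRoot
      have hsub : {v : ℂ | v ≠ 0} ⊆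
          {x | Polynomial.IsRoot (aeval ![Polynomial.C w, Polynomial.X] P) x} := by
        intro v hv
        rw [Set.mem_setOf_eq, Polynomial.IsRoot.def, eval_aeval_C_X, ← Complex.exp_log hv]
        exact h1 _ _
      refine Set.Infinite.mono hsub ?_
      have : ({v : ℂ | v ≠ 0}) = (Set.univ \ {0}) := by ext; simp
      rw [this]
      exact Set.infinite_univ.sdiff (Set.finite_singleton 0)
    have := congrArg (fun q => Polynomial.eval v q) hzero
    simpa [eval_aeval_C_X] using this
  apply MvPolynomial.funext
  intro x
  have hx : x = ![x 0, x 1] := by ext i; fin_cases i <;> rfl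
  rw [hx, map_zero]
  exact h2 _ _

/-- There is a point where `P(z, e^z) ≠ 0`, for `P ≠ 0`. [folklore] -/
theorem exists_eval_exp_ne_zero {P : MvPolynomial (Fin 2) ℂ} (hP : P ≠ 0) :
    ∃ z : ℂ, eval ![z, exp z] P ≠ 0 := by
  by_contra h
  push Not at h
  exact hP (eq_zero_of_forall_eval_exp_eq_zero P h)

/-! ### Analyticity of `z ↦ P(z, e^z)` and its consequences -/

/-- `z ↦ P(z, e^z)` is differentiable (entire). [folklore] -/
theorem differentiable_eval_exp (P : MvPolynomial (Fin 2) ℂ) :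
    Differentiable ℂ (fun z => eval ![z, exp z] P) := by
  induction P using MvPolynomial.induction_on with
  | C a => simp
  | add p q hp hq => simp only [map_add]; exact hp.add hq
  | mul_X p i hp =>
    simp only [map_mul, eval_X]
    refine hp.mul ?_
    fin_cases i
    · exact differentiable_id
    · exact Complex.differentiable_exp

/-- `z ↦ P(z, e^z)` is analytic on `ℂ`. [folklore] -/
theorem analyticOnNhd_eval_exp (P : MvPolynomial (Fin 2) ℂ) :
    AnalyticOnNhd ℂ (fun z => eval ![z, exp z] P) Set.univ :=
  (differentiable_eval_exp P).differentiableOn.analyticOnNhd isOpen_univ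

/-- If `P ≠ 0`, the zeros of `P(z, e^z)` do not accumulate: `P(z, e^z)` is not frequently zero
on any punctured neighbourhood. [folklore] -/
theorem not_frequently_eval_exp_eq_zero {P : MvPolynomial (Fin 2) ℂ} (hP : P ≠ 0) (z₀ : ℂ) :
    ¬ ∃ᶠ z in 𝓝[≠] z₀, eval ![z, exp z] P = 0 := by
  intro hfr
  have h := (analyticOnNhd_eval_exp P).eqOn_zero_of_preconnected_of_frequently_eq_zero
    isPreconnected_univ (Set.mem_univ z₀) hfr
  obtain ⟨z, hz⟩ := exists_eval_exp_ne_zero hP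
  exact hz (h (Set.mem_univ z))

/-- **Finitely many zeros of `P(z, e^z)` in a compact set** (`P ≠ 0`). [folklore] -/
theorem finite_zeros_eval_exp_of_isCompact {P : MvPolynomial (Fin 2) ℂ} (hP : P ≠ 0)
    {K : Set ℂ} (hK : IsCompact K) :
    Set.Finite {z ∈ K | eval ![z, exp z] P = 0} := by
  by_contra hinf
  obtain ⟨z₀, -, hacc⟩ := (Set.not_finite.1 hinf).exists_accPt_of_subset_isCompact hK
    (fun z hz => hz.1)
  rw [accPt_iff_frequently_nhdsNE] at hacc
  exact not_frequently_eval_exp_eq_zero hP z₀ (hacc.mono fun z hz => hz.2)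

/-- **Finitely many zeros of `P(z, e^z)` in a closed ball** (`P ≠ 0`). [folklore] -/
theorem finite_zeros_eval_exp_norm_le {P : MvPolynomial (Fin 2) ℂ} (hP : P ≠ 0) (R : ℝ) :
    Set.Finite {z : ℂ | ‖z‖ ≤ R ∧ eval ![z, exp z] P = 0} := by
  have h := finite_zeros_eval_exp_of_isCompact hP (isCompact_closedBall (0 : ℂ) R)
  refine h.subset ?_
  rintro z ⟨hz, hz'⟩
  exact ⟨mem_closedBall_zero_iff.2 hz, hz'⟩

/-- A point of a preconnected set with at least two points is a limit of other points of the
set. [folklore] -/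
theorem mem_closure_diff_singleton_of_isPreconnected {X : Type*} [TopologicalSpace X] [T1Space X]
    {T : Set X} (hT : IsPreconnected T) {a b : X} (ha : a ∈ T) (hb : b ∈ T) (hab : a ≠ b) :
    a ∈ closure (T \ {a}) := by
  by_contra hcl
  -- an open neighbourhood of `a` missing `T \ {a}`
  have hopen : IsOpen (closure (T \ {a}))ᶜ := isClosed_closure.isOpen_compl
  have hne := hT (closure (T \ {a}))ᶜ ({a}ᶜ) hopen isOpen_compl_singleton
    (fun x hx => by
      by_cases hxa : x = a
      · left; rwa [hxa]
      · right; exact hxa)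
    ⟨a, ha, hcl⟩ ⟨b, hb, hab.symm⟩
  obtain ⟨x, hxT, hx1, hx2⟩ := hne
  exact hx1 (subset_closure ⟨hxT, hx2⟩)

/-- **`P(f, e^f) = 0` on a preconnected set forces `f` constant there** (`P ≠ 0`, `f`
continuous): the image `f(S)` is a preconnected subset of the zero set of the entire function
`P(z, e^z) ≢ 0`, whose points are isolated. This is the form in which "`e^f` is algebraic over
`ℂ(f)` only for constant `f`" is used on branches of curves. [folklore] -/
theorem eval_exp_const_of_isPreconnected {X : Type*} [TopologicalSpace X] {S : Set X}
    (hS : IsPreconnected S) {f : X → ℂ} (hf : ContinuousOn f S) {P : MvPolynomial (Fin 2) ℂ}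
    (hP : P ≠ 0) (h : ∀ x ∈ S, eval ![f x, exp (f x)] P = 0) :
    ∀ x ∈ S, ∀ y ∈ S, f x = f y := by
  intro x hx y hy
  by_contra hne
  have hT : IsPreconnected (f '' S) := hS.image f hf
  have hcl := mem_closure_diff_singleton_of_isPreconnected hT (Set.mem_image_of_mem f hx)
    (Set.mem_image_of_mem f hy) hne
  -- `f x` is an accumulation point of the zero set
  have hsub : f '' S \ {f x} ⊆ {z | eval ![z, exp z] P = 0} \ {f x} := by
    rintro _ ⟨⟨u, hu, rfl⟩, hne'⟩
    exact ⟨h u hu, hne'⟩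
  have hmem : f x ∈ closure ({z | eval ![z, exp z] P = 0} \ {f x}) :=
    closure_mono hsub hcl
  have h0 := (analyticOnNhd_eval_exp P).eqOn_zero_of_preconnected_of_mem_closure
    isPreconnected_univ (Set.mem_univ (f x)) hmem
  obtain ⟨z, hz⟩ := exists_eval_exp_ne_zero hP
  exact hz (h0 (Set.mem_univ z))

end Literature.NumberTheory.Transcendental

end
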